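import Summits.MatrixMultiplication.OmegaCensus.STPP222TetraReflect
import Summits.MatrixMultiplication.OmegaCensus.STPP222CubeCover

/-!
# ω-census, the pattern `(2,2,2)⁴`: sorting the triples `1, 2, 3` (the search's weak lex order)

HONEST FRAMING (pub-omega census; verbatim): lottery ticket; floor = certified bounds/negative ranges.
Census STRUCTURE bookkeeping (question Q7, row `k = 4`: a KERNEL leg for the lower half `n₄ ≥ 56` on the cell `(ℤ/2)⁵`, whose
census engine legs need `GL₅(𝔽₂)`-sized symmetry handling — ENG2 cfind n4b, ENG1 c4x via a Borel subgroup), not progress on `ω`.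

The reflection theorem demands the triples `1, 2, 3` in weak lex order of `(code q, code q')`; an arbitrary labelled family is brought there by
at most three swaps of triples (re-indexing, `STPP222CubeNeg.isSTPP_reindex`), each transporting the normal form and the
lex-free hypotheses `HypsNoLex`: `nf_contra4`.

References: H. Cohn, R. Kleinberg, B. Szegedy, C. Umans, FOCS 2005 (arXiv:math/0511460), Def. 5.1.
Record: pub-omega HOME `pub-omega-eng2-g23/tetra/` (ENG2 gen 23, 2026-08-26): generators `k4gen.py` (clause lists; levels 0–12 are
literally the `(2,2,2)³` words), `search4.py` (Python mirror of this engine, node-for-node equal to the C census engine cfind v1.2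
run WITHOUT symmetry flags on `(ℤ/2)⁵`: 48 024 nodes / 4 115 340 clause evaluations, INFEASIBLE), `gen5.py` (the `GL₅(𝔽₂)` cover maps).
-/

open Literature.Computability.AlgebraicComplexity Finset

namespace Summit.MatrixMultiplication.OmegaCensus

namespace STPP222TetraNeg

/-! ## 8. Re-indexing the triples `1, 2, 3` (the search's weak lex order) -/

open STPP222SqNeg (qcovB exists_qs_of_qcovB isSTPP_translate)
open STPP222CubeNeg (isSTPP_reindex)

/-- The swap of triples 1 and 2. -/
def σ12 : Fin 4 → Fin 4 := ![0, 2, 1, 3]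

/-- The swap of triples 2 and 3. -/
def σ23 : Fin 4 → Fin 4 := ![0, 1, 3, 2]

/-- `σ12` is injective. -/
theorem σ12_inj : Function.Injective σ12 := by decide

/-- `σ23` is injective. -/
theorem σ23_inj : Function.Injective σ23 := by decide

/-- The swap of triples 1 and 2 on the variables. -/
def V18.swap12 : V18 → V18
  | .a0 => .a0 | .b0 => .b0 | .c0 => .c0 | .q1 => .q2 | .r1 => .r2 | .q1' => .q2' | .r1' => .r2' | .a1 => .a2
  | .q2 => .q1 | .r2 => .r1 | .q2' => .q1' | .r2' => .r1' | .a2 => .a1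
  | .q3 => .q3 | .r3 => .r3 | .q3' => .q3' | .r3' => .r3' | .a3 => .a3

/-- The swap of triples 2 and 3 on the variables. -/
def V18.swap23 : V18 → V18
  | .a0 => .a0 | .b0 => .b0 | .c0 => .c0 | .q1 => .q1 | .r1 => .r1 | .q1' => .q1' | .r1' => .r1' | .a1 => .a1
  | .q2 => .q3 | .r2 => .r3 | .q2' => .q3' | .r2' => .r3' | .a2 => .a3
  | .q3 => .q2 | .r3 => .r2 | .q3' => .q2' | .r3' => .r2' | .a3 => .a2

/-- The swap of triples 1 and 2 on triple indices. -/
def T4.swap12 : T4 → T4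
  | .t0 => .t0 | .t1 => .t2 | .t2 => .t1 | .t3 => .t3

/-- The swap of triples 2 and 3 on triple indices. -/
def T4.swap23 : T4 → T4
  | .t0 => .t0 | .t1 => .t1 | .t2 => .t3 | .t3 => .t2

/-- Entries of the swapped assignment (`A`, swap 1 2). -/
theorem gA_swap12 {G : Type} [AddCommGroup G] (val : V18 → G) (t : T4) (e : Bool) :
    gA (val ∘ V18.swap12) t e = gA val t.swap12 e := by cases t <;> cases e <;> rfl

/-- Entries of the swapped assignment (`B`, swap 1 2). -/
theorem gB_swap12 {G : Type} [AddCommGroup G] (val : V18 → G) (t : T4) (e : Bool) :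
    gB (val ∘ V18.swap12) t e = gB val t.swap12 e := by cases t <;> cases e <;> rfl

/-- Entries of the swapped assignment (`C`, swap 1 2). -/
theorem gC_swap12 {G : Type} [AddCommGroup G] (val : V18 → G) (t : T4) (e : Bool) :
    gC (val ∘ V18.swap12) t e = gC val t.swap12 e := by cases t <;> cases e <;> rfl

/-- Entries of the swapped assignment (`A`, swap 2 3). -/
theorem gA_swap23 {G : Type} [AddCommGroup G] (val : V18 → G) (t : T4) (e : Bool) :
    gA (val ∘ V18.swap23) t e = gA val t.swap23 e := by cases t <;> cases e <;> rfl

/-- Entries of the swapped assignment (`B`, swap 2 3). -/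
theorem gB_swap23 {G : Type} [AddCommGroup G] (val : V18 → G) (t : T4) (e : Bool) :
    gB (val ∘ V18.swap23) t e = gB val t.swap23 e := by cases t <;> cases e <;> rfl

/-- Entries of the swapped assignment (`C`, swap 2 3). -/
theorem gC_swap23 {G : Type} [AddCommGroup G] (val : V18 → G) (t : T4) (e : Bool) :
    gC (val ∘ V18.swap23) t e = gC val t.swap23 e := by cases t <;> cases e <;> rfl

/-- The normal form is preserved by the swap of triples 1 and 2. -/
theorem NF.swap12 {G : Type} [AddCommGroup G] {SA SB SC : Fin 4 → Finset G} {val : V18 → G}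
    (h : NF SA SB SC val) :
    NF (fun t => SA (σ12 t)) (fun t => SB (σ12 t)) (fun t => SC (σ12 t)) (val ∘ V18.swap12) where
  memA t e := by rw [gA_swap12, show σ12 (fin4 t) = fin4 t.swap12 by cases t <;> rfl]; exact h.memA _ _
  memB t e := by rw [gB_swap12, show σ12 (fin4 t) = fin4 t.swap12 by cases t <;> rfl]; exact h.memB _ _
  memC t e := by rw [gC_swap12, show σ12 (fin4 t) = fin4 t.swap12 by cases t <;> rfl]; exact h.memC _ _
  injA t e₁ e₂ he := h.injA t.swap12 e₁ e₂ (by rwa [gA_swap12, gA_swap12] at he)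
  injB t e₁ e₂ he := h.injB t.swap12 e₁ e₂ (by rwa [gB_swap12, gB_swap12] at he)
  injC t e₁ e₂ he := h.injC t.swap12 e₁ e₂ (by rwa [gC_swap12, gC_swap12] at he)

/-- The normal form is preserved by the swap of triples 2 and 3. -/
theorem NF.swap23 {G : Type} [AddCommGroup G] {SA SB SC : Fin 4 → Finset G} {val : V18 → G}
    (h : NF SA SB SC val) :
    NF (fun t => SA (σ23 t)) (fun t => SB (σ23 t)) (fun t => SC (σ23 t)) (val ∘ V18.swap23) where
  memA t e := by rw [gA_swap23, show σ23 (fin4 t) = fin4 t.swap23 by cases t <;> rfl]; exact h.memA _ _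
  memB t e := by rw [gB_swap23, show σ23 (fin4 t) = fin4 t.swap23 by cases t <;> rfl]; exact h.memB _ _
  memC t e := by rw [gC_swap23, show σ23 (fin4 t) = fin4 t.swap23 by cases t <;> rfl]; exact h.memC _ _
  injA t e₁ e₂ he := h.injA t.swap23 e₁ e₂ (by rwa [gA_swap23, gA_swap23] at he)
  injB t e₁ e₂ he := h.injB t.swap23 e₁ e₂ (by rwa [gB_swap23, gB_swap23] at he)
  injC t e₁ e₂ he := h.injC t.swap23 e₁ e₂ (by rwa [gC_swap23, gC_swap23] at he)

/-- The hypotheses of the reflection theorem WITHOUT the lex order of the triples (what a normal form with ordered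
pairs supplies before sorting the triples `1, 2, 3`). -/
structure HypsNoLex {G : Type} [AddCommGroup G] (E : EncH G) (val : V18 → G) : Prop where
  /-- `a₀ ≠ 0` -/ a0 : val .a0 ≠ 0
  /-- `a₁ ≠ 0` -/ a1 : val .a1 ≠ 0
  /-- `a₂ ≠ 0` -/ a2 : val .a2 ≠ 0
  /-- `a₃ ≠ 0` -/ a3 : val .a3 ≠ 0
  /-- `b₀ ≠ 0` -/ b0 : val .b0 ≠ 0
  /-- `c₀ ≠ 0` -/ c0 : val .c0 ≠ 0
  /-- `B 1` ordered -/ q1 : E.enc (val .q1) < E.enc (val .q1')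
  /-- `C 1` ordered -/ r1 : E.enc (val .r1) < E.enc (val .r1')
  /-- `B 2` ordered -/ q2 : E.enc (val .q2) < E.enc (val .q2')
  /-- `C 2` ordered -/ r2 : E.enc (val .r2) < E.enc (val .r2')
  /-- `B 3` ordered -/ q3 : E.enc (val .q3) < E.enc (val .q3')
  /-- `C 3` ordered -/ r3 : E.enc (val .r3) < E.enc (val .r3')

/-- `HypsNoLex` is preserved by the swap of triples 1 and 2. -/
theorem HypsNoLex.swap12 {G : Type} [AddCommGroup G] {E : EncH G} {val : V18 → G} (h : HypsNoLex E val) :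
    HypsNoLex E (val ∘ V18.swap12) :=
  ⟨h.a0, h.a2, h.a1, h.a3, h.b0, h.c0, h.q2, h.r2, h.q1, h.r1, h.q3, h.r3⟩

/-- `HypsNoLex` is preserved by the swap of triples 2 and 3. -/
theorem HypsNoLex.swap23 {G : Type} [AddCommGroup G] {E : EncH G} {val : V18 → G} (h : HypsNoLex E val) :
    HypsNoLex E (val ∘ V18.swap23) :=
  ⟨h.a0, h.a1, h.a3, h.a2, h.b0, h.c0, h.q1, h.r1, h.q3, h.r3, h.q2, h.r2⟩

/-- The weak lex comparison of two triples by `(code q, code q')`. -/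
def LexLE (q q' p p' : ℕ) : Prop := q ≤ p ∧ (p = q → q' ≤ p')

/-- `LexLE` is total. -/
theorem lexLE_total (q q' p p' : ℕ) : LexLE q q' p p' ∨ LexLE p p' q q' := by
  unfold LexLE; omega

/-- SORTED CASE: with the triples already in weak lex order, the reflection theorem applies.
[cite: CohnKleinbergSzegedyUmans2005, Def. 5.1] -/
theorem contra_sorted {G : Type} [AddCommGroup G] (E : EncH G) {el : List ℕ} (hel : ∀ g : G, E.enc g ∈ el)
    {reps : List (ℕ × ℕ × ℕ × List ℕ)} (hs : searchB4 E.A el reps = true) (hq : qcovB el reps = true)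
    {SA SB SC : Fin 4 → Finset G} (hS : IsSTPP SA SB SC) {val : V18 → G} (hN : NF SA SB SC val)
    (hH : HypsNoLex E val)
    (h12 : LexLE (E.enc (val .q1)) (E.enc (val .q1')) (E.enc (val .q2)) (E.enc (val .q2')))
    (h23 : LexLE (E.enc (val .q2)) (E.enc (val .q2')) (E.enc (val .q3)) (E.enc (val .q3')))
    {qs : List ℕ} (hrep : (E.enc (val .a0), E.enc (val .b0), E.enc (val .c0), qs) ∈ reps) : False := by
  obtain ⟨qs', hrep', hq'⟩ := exists_qs_of_qcovB hq hrep (hel (val .q1))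
  exact nf_false_of_searchB4 E hel hs hS hN
    ⟨hH.a0, hH.a1, hH.a2, hH.a3, hH.b0, hH.c0, hH.q1, hH.r1, hH.q2, hH.r2, hH.q3, hH.r3, h12.1, h12.2, h23.1, h23.2⟩
    hrep' hq'

/-- From a normal form with nonzero differences and ordered pairs (no condition between the triples `1, 2, 3`) to a
contradiction: sort the three triples by at most three swaps, then apply the reflection theorem.
[cite: CohnKleinbergSzegedyUmans2005, Def. 5.1] -/
theorem nf_contra4 {G : Type} [AddCommGroup G] (E : EncH G) {el : List ℕ} (hel : ∀ g : G, E.enc g ∈ el)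
    {reps : List (ℕ × ℕ × ℕ × List ℕ)} (hs : searchB4 E.A el reps = true) (hq : qcovB el reps = true)
    {SA SB SC : Fin 4 → Finset G} (hS : IsSTPP SA SB SC) {val : V18 → G} (hN : NF SA SB SC val)
    (hH : HypsNoLex E val) {qs : List ℕ} (hrep : (E.enc (val .a0), E.enc (val .b0), E.enc (val .c0), qs) ∈ reps) :
    False := by
  -- the three keys
  have T12 := lexLE_total (E.enc (val .q1)) (E.enc (val .q1')) (E.enc (val .q2)) (E.enc (val .q2'))
  have T23 := lexLE_total (E.enc (val .q2)) (E.enc (val .q2')) (E.enc (val .q3)) (E.enc (val .q3'))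
  have T13 := lexLE_total (E.enc (val .q1)) (E.enc (val .q1')) (E.enc (val .q3)) (E.enc (val .q3'))
  -- one swap of triples 1, 2 / 2, 3 applied to an arbitrary labelled family
  have S12 : ∀ {SA SB SC : Fin 4 → Finset G} {val : V18 → G}, IsSTPP SA SB SC → NF SA SB SC val →
      HypsNoLex E val → (E.enc (val .a0), E.enc (val .b0), E.enc (val .c0), qs) ∈ reps →
      ∃ (SA' SB' SC' : Fin 4 → Finset G), IsSTPP SA' SB' SC' ∧ NF SA' SB' SC' (val ∘ V18.swap12) ∧
        HypsNoLex E (val ∘ V18.swap12) ∧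
        (E.enc ((val ∘ V18.swap12) .a0), E.enc ((val ∘ V18.swap12) .b0), E.enc ((val ∘ V18.swap12) .c0), qs)
          ∈ reps :=
    fun hS hN hH hrep => ⟨_, _, _, isSTPP_reindex hS σ12_inj, hN.swap12, hH.swap12, hrep⟩
  have S23 : ∀ {SA SB SC : Fin 4 → Finset G} {val : V18 → G}, IsSTPP SA SB SC → NF SA SB SC val →
      HypsNoLex E val → (E.enc (val .a0), E.enc (val .b0), E.enc (val .c0), qs) ∈ reps →
      ∃ (SA' SB' SC' : Fin 4 → Finset G), IsSTPP SA' SB' SC' ∧ NF SA' SB' SC' (val ∘ V18.swap23) ∧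
        HypsNoLex E (val ∘ V18.swap23) ∧
        (E.enc ((val ∘ V18.swap23) .a0), E.enc ((val ∘ V18.swap23) .b0), E.enc ((val ∘ V18.swap23) .c0), qs)
          ∈ reps :=
    fun hS hN hH hrep => ⟨_, _, _, isSTPP_reindex hS σ23_inj, hN.swap23, hH.swap23, hrep⟩
  rcases T12 with h12 | h21 <;> rcases T23 with h23 | h32
  · -- order 1 2 3
    exact contra_sorted E hel hs hq hS hN hH h12 h23 hrep
  · rcases T13 with h13 | h31
    · -- order 1 3 2: swap 2 3
      obtain ⟨_, _, _, hS', hN', hH', hrep'⟩ := S23 hS hN hH hrep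
      exact contra_sorted E hel hs hq hS' hN' hH' h13 h32 hrep'
    · -- order 3 1 2: swap 2 3, then swap 1 2
      obtain ⟨_, _, _, hS', hN', hH', hrep'⟩ := S23 hS hN hH hrep
      obtain ⟨_, _, _, hS'', hN'', hH'', hrep''⟩ := S12 hS' hN' hH' hrep'
      exact contra_sorted E hel hs hq hS'' hN'' hH'' h31 h12 hrep''
  · rcases T13 with h13 | h31
    · -- order 2 1 3: swap 1 2
      obtain ⟨_, _, _, hS', hN', hH', hrep'⟩ := S12 hS hN hH hrep
      exact contra_sorted E hel hs hq hS' hN' hH' h21 h13 hrep'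
    · -- order 2 3 1: swap 1 2, then swap 2 3
      obtain ⟨_, _, _, hS', hN', hH', hrep'⟩ := S12 hS hN hH hrep
      obtain ⟨_, _, _, hS'', hN'', hH'', hrep''⟩ := S23 hS' hN' hH' hrep'
      exact contra_sorted E hel hs hq hS'' hN'' hH'' h23 h31 hrep''
  · -- order 3 2 1: swap 1 2, swap 2 3, swap 1 2
    obtain ⟨_, _, _, hS', hN', hH', hrep'⟩ := S12 hS hN hH hrep
    obtain ⟨_, _, _, hS'', hN'', hH'', hrep''⟩ := S23 hS' hN' hH' hrep'
    obtain ⟨_, _, _, hS''', hN''', hH''', hrep'''⟩ := S12 hS'' hN'' hH'' hrep''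
    exact contra_sorted E hel hs hq hS''' hN''' hH''' h32 h21 hrep'''

end STPP222TetraNeg

end Summit.MatrixMultiplication.OmegaCensus
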